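import Mathlib
import HarnessLib
import Summits.HubbardSuperconductivity.HubbardSuperconductivity.Theorems.KLProgrammeC4aFoldBoxPreLawLinePrimed
import Summits.HubbardSuperconductivity.HubbardSuperconductivity.Theorems.KLProgrammeC4aPreCausticLevelLineMiddle

/-!
# Route `KLProgramme` — crux C4a, S3 brick (B4) «(U1)-M-LAW» part 2 (5c-M): the pre-caustic level line of the ACTUAL partner band for the COMPARABLE-LEVELS kernel
# piece — `…C4aPreCausticLevelLineMiddle.abs_intervalIntegral_levelLine_middle_le` (5b-M) instantiated with the fold-box geometry of `…C4aFoldBoxPreLawLine(Primed)`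

Cell `gate-hubbard-kl`, seat hubbard-kl-k3c3-p3 (g34; row «implicit-function / monotonicity route for μ(n)»).  Located brick for the (C)-closer lane / the (M4)
assembly of the umklapp first-order ϑ-layer (stub (C) `stub_twoLeg_curvature` of `KLRegimeEngineV17F2`, stmt-HubbardSuperconductivity-20437), memo
HOME/hubbard-kl-k3c3-p3/U1-CAUSTIC-SUP.md §17.

WHY.  Sibling of `…C4aFoldBoxPreLawLinePrimed.abs_levelLine_partnerBand_pre_le'` (5c′) for the comparable-levels piece `M` of the true pp kernel (k3c3-p1's partition
`P = A + A′ + M`, `…C4aPPKernelPartition`): same geometry (fold point `vs`, offset `δ₀ > 0`, caustic budget `Δ`, rate window `hratey`), kernel rows of 5b-M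
(`hcomp`, `hKopp`, band flatness `hflatB` with the `A_fl·lo/max(D,lo)² + B_fl` slot) in place of `hsupp`/`hflat`.  The whole-line deviation row of 5b-M is ALREADY in the tree:
`…C4aFoldBoxPreLawLine.abs_partnerBand_sub_antidiagonal_le` with `e₁ := e` gives `|ē(e) − (D − e)| ≤ (K₂/(Dt−2A))·(d_c(y) + 2e/(Dt−2A))·e`, and the caustic distance at the
loop angle `y` obeys `d_c(y) ≤ C₀·D(y) + 2msD₁|y − vs|` (5c′'s `hDy`, from `norm_caustic_le_of_foldPoint` + `norm_caustic_sub_two_smul_le`), so `c₁ = (K₂/(Dt−2A))(C₀D + 2msD₁|y−vs|)`,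
`K_d = 2K₂/(Dt−2A)²`.  OUTPUT SHAPE = the three-slot `hF` row of `…C4aPreCausticAngleLayer.intervalIntegral_pre_caustic_angle_le` (so the existing angle layer applies
verbatim): `A₁ = X₀A_fl + WX₀C_t` (the thermal tail rides in the flatness slot), `A₂ = 32C³WX₀(K₂/(Dt−2A))msD₁`, `A₃ = 16C³WX₀(K₂/(Dt−2A))C₀ + 128C³WX₀K₂/(Dt−2A)² + 16C²WX₁ + X₀B_fl`,
`C = q_c + 3/2`.
* **`abs_levelLine_partnerBand_middle_le`** (HEADLINE).
Sizes binder shape + `GeomConstants`; nothing asserts (C), K3 or superconductivity.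
References: FST II CPAM 51 (1998) §3 [cite: FeldmanSalmhoferTrubowitz1998]; Salmhofer 1999 §4.5.3 [cite: Salmhofer1999].
-/

noncomputable section

namespace Summit.HubbardSuperconductivity.HubbardSuperconductivity.Theorems.C4a

set_option linter.dupNamespace false -- summit = problem name (single-conjunct summit), D-0017

open Real Set MeasureTheory intervalIntegral
open Literature.MathematicalPhysics.QuantumLattice Literature.MathematicalPhysics.QuantumLattice.BandSectorCounting
open Literature.MathematicalPhysics.QuantumLattice.FermiRG
open Summit.HubbardSuperconductivity.HubbardSuperconductivity.Theorems.KLRegimeSplit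
open Summit.HubbardSuperconductivity.HubbardSuperconductivity.Theorems.DispersionFlow
open Summit.HubbardSuperconductivity.HubbardSuperconductivity.Theorems.PerturbedFermiCurve

section Sizes

variable {K : TrigPolyC4v} {A : ℝ} (hA : ∀ p : Momentum, ∀ j ≤ 2, ‖iteratedFDeriv ℝ j (frameShift K) p‖ ≤ A) (hA20 : A ≤ 1 / 20)
  (hd : klCurveD ≤ (bandBounds (show (-4 : ℝ) < -1.1 by norm_num) (show (-1.1 : ℝ) ≤ -0.1 by norm_num)
    (show (-0.1 : ℝ) < 0 by norm_num)).Dtmin - 2 * A)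
  {μ r : ℝ} (hr : 0 < r) (hlo : (-1.1 : ℝ) < μ - r - A) (hhi : μ + r + A < -0.1)
  {A₃ A₄ : ℝ} (hA₃ : ∀ p : Momentum, ‖iteratedFDeriv ℝ 3 (frameShift K) p‖ ≤ A₃)
  (hA₄ : ∀ p : Momentum, ‖iteratedFDeriv ℝ 4 (frameShift K) p‖ ≤ A₄)
  {K₁ K₂ K₃ : ℝ} (hK₁ : ∀ p : Momentum, ‖fderiv ℝ (frameLevel μ K) p‖ ≤ K₁) (hK₂ : ∀ p : Momentum, ‖iteratedFDeriv ℝ 2 (frameLevel μ K) p‖ ≤ K₂)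
  (hK₃ : ∀ p : Momentum, ‖iteratedFDeriv ℝ 3 (frameLevel μ K) p‖ ≤ K₃)
include hA hA20 hd hr hlo hhi hA₃ hA₄ hK₁ hK₂ hK₃


omit hK₃ in
/-- **THE PRE-CAUSTIC LEVEL LINE OF THE PARTNER BAND, COMPARABLE-LEVELS KERNEL PIECE** (HEADLINE; see the module docstring): the geometry of 5c′, the kernel rows of
5b-M; conclusion in the three-slot shape `A₁·(lo/max(D,lo)²) + A₂·(|y − vs|/D) + A₃` of the angle layer. -/
theorem abs_levelLine_partnerBand_middle_le {Kc r₀ g₀ w : ℝ} (hG : GeomConstants (frameLevel μ K) Kc r₀ g₀ w) (S : Momentum) (m : Fin 2 → ℤ) (θ : ℝ)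
    {y vs Δ lo hi qc X₀ X₁ W Afl Bfl Ct : ℝ} {Kr : ℝ → ℝ → ℝ} {X wt : ℝ → ℝ}
    (hcrit : deriv (fun x : ℝ => frameLevel μ K (S - levelPoint μ K 0 (x + θ))) vs = 0)
    (hδ₀ : 0 < frameLevel μ K (S - levelPoint μ K 0 (vs + θ)))
    (hmin : frameLevel μ K (S - levelPoint μ K 0 (vs + θ)) ≤ frameLevel μ K (S - levelPoint μ K 0 (y + θ)))
    (hDist : ‖S - WithLp.toLp 2 (fun i => 2 * π * (m i : ℝ)) - (2 : ℝ) • levelPoint μ K 0 (vs + θ)‖ ≤ Δ) (hΔ : Δ ≤ 3 / 10)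
    (hΔu : Δ ≤ (bandBounds (show (-4 : ℝ) < -1.1 by norm_num) (show (-1.1 : ℝ) ≤ -0.1 by norm_num) (show (-0.1 : ℝ) < 0 by norm_num)).umin) (hΔr : K₁ * Δ < r)
    (hlo0 : 0 < lo) (hlohi : lo ≤ hi) (hhir : hi < r) (hqc : 4 ≤ qc) (hX₁ : 0 ≤ X₁) (hAfl : 0 ≤ Afl) (hBfl : 0 ≤ Bfl) (hCt : 0 ≤ Ct)
    (hratey : ∀ s ∈ Icc 0 hi, K₂ * ‖S - WithLp.toLp 2 (fun i => 2 * π * (m i : ℝ)) - (2 : ℝ) • levelPoint μ K s (y + θ)‖ /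
        ((bandBounds (show (-4 : ℝ) < -1.1 by norm_num) (show (-1.1 : ℝ) ≤ -0.1 by norm_num) (show (-0.1 : ℝ) < 0 by norm_num)).Dtmin - 2 * A) ≤ 1 / 2)
    (hK : ∀ e ∈ Icc lo hi, ContDiff ℝ 2 (Kr e)) (hK1 : ∀ e ∈ Icc lo hi, ∀ u, |deriv (Kr e) u| ≤ (max e |u|)⁻¹ ^ 2)
    (hK2 : ∀ e ∈ Icc lo hi, ∀ u, |iteratedDeriv 2 (Kr e) u| ≤ (max e |u|)⁻¹ ^ 3)
    (hcomp : ∀ e ∈ Icc lo hi, ∀ u, qc * e ≤ |u| → deriv (Kr e) u = 0)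
    (hKopp : ∀ e ∈ Icc lo hi, ∀ u, u ≤ -(e / 4) → |deriv (Kr e) u| ≤ Ct * lo * (max e |u|)⁻¹ ^ 3)
    (hKc : Continuous fun p : ℝ × ℝ => deriv (Kr p.1) p.2)
    (hflatB : |∫ e in (max lo (frameLevel μ K (S - levelPoint μ K 0 (y + θ)) / (qc + 3 / 2)))..(min hi (4 * frameLevel μ K (S - levelPoint μ K 0 (y + θ)))),
        wt e * deriv (Kr e) (frameLevel μ K (S - levelPoint μ K 0 (y + θ)) - e)| ≤
      Afl * (lo / (max (frameLevel μ K (S - levelPoint μ K 0 (y + θ))) lo) ^ 2) + Bfl)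
    (hwc : ContinuousOn wt (Icc lo hi)) (hw0 : ∀ e ∈ Icc lo hi, 0 ≤ wt e) (hwW : ∀ e ∈ Icc lo hi, wt e ≤ W)
    (hXc : ContinuousOn X (Icc lo hi)) (hX0 : ∀ e ∈ Icc lo hi, |X e| ≤ X₀) (hXL : ∀ e ∈ Icc lo hi, |X e - X lo| ≤ X₁ * |e - lo|) :
    |∫ e in lo..hi, wt e * X e * deriv (Kr e) (frameLevel μ K (S - levelPoint μ K e (y + θ)))| ≤
      (X₀ * Afl + W * X₀ * Ct) * (lo / (max (frameLevel μ K (S - levelPoint μ K 0 (y + θ))) lo) ^ 2) +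
        32 * (qc + 3 / 2) ^ 3 * W * X₀ * (K₂ / ((bandBounds (show (-4 : ℝ) < -1.1 by norm_num) (show (-1.1 : ℝ) ≤ -0.1 by norm_num) (show (-0.1 : ℝ) < 0 by norm_num)).Dtmin - 2 * A)) * msD A₃ A₄ 1 *
          (|y - vs| / frameLevel μ K (S - levelPoint μ K 0 (y + θ))) +
        (16 * (qc + 3 / 2) ^ 3 * W * X₀ * (K₂ / ((bandBounds (show (-4 : ℝ) < -1.1 by norm_num) (show (-1.1 : ℝ) ≤ -0.1 by norm_num) (show (-0.1 : ℝ) < 0 by norm_num)).Dtmin - 2 * A)) *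
            (1 / ((bandBounds (show (-4 : ℝ) < -1.1 by norm_num) (show (-1.1 : ℝ) ≤ -0.1 by norm_num) (show (-0.1 : ℝ) < 0 by norm_num)).Dtmin - 2 * A) + msD A₃ A₄ 1 * (π * (4 + 2 * A) * Kc / ((bandBounds (show (-4 : ℝ) < -1.1 by norm_num) (show (-1.1 : ℝ) ≤ -0.1 by norm_num) (show (-0.1 : ℝ) < 0 by norm_num)).umin * w * ((bandBounds (show (-4 : ℝ) < -1.1 by norm_num) (show (-1.1 : ℝ) ≤ -0.1 by norm_num) (show (-0.1 : ℝ) < 0 by norm_num)).Dtmin - 2 * A) ^ 2))) +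
          128 * (qc + 3 / 2) ^ 3 * W * X₀ * (K₂ / ((bandBounds (show (-4 : ℝ) < -1.1 by norm_num) (show (-1.1 : ℝ) ≤ -0.1 by norm_num) (show (-0.1 : ℝ) < 0 by norm_num)).Dtmin - 2 * A) ^ 2) + 16 * (qc + 3 / 2) ^ 2 * W * X₁ + X₀ * Bfl) := by
  set B := bandBounds (show (-4 : ℝ) < -1.1 by norm_num) (show (-1.1 : ℝ) ≤ -0.1 by norm_num) (show (-0.1 : ℝ) < 0 by norm_num) with hBdef
  set v : Momentum := WithLp.toLp 2 (fun i => 2 * π * (m i : ℝ)) with hv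
  obtain ⟨D, hDdef⟩ : ∃ D : ℝ, D = frameLevel μ K (S - levelPoint μ K 0 (y + θ)) := ⟨_, rfl⟩
  obtain ⟨δ₀, hδ₀def⟩ : ∃ δ₀ : ℝ, δ₀ = frameLevel μ K (S - levelPoint μ K 0 (vs + θ)) := ⟨_, rfl⟩
  rw [← hDdef] at hflatB hmin ⊢
  rw [← hδ₀def] at hδ₀ hmin
  obtain ⟨C₀, hC₀⟩ : ∃ C₀ : ℝ, C₀ = 1 / (B.Dtmin - 2 * A) + msD A₃ A₄ 1 * (π * (4 + 2 * A) * Kc / (B.umin * w * (B.Dtmin - 2 * A) ^ 2)) := ⟨_, rfl⟩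
  rw [← hC₀]
  have hADt : 2 * A < B.Dtmin := by have := klCurveD_pos; linarith
  have hDt : 0 < B.Dtmin - 2 * A := by linarith
  have hK₂0 : 0 ≤ K₂ := (norm_nonneg _).trans (hK₂ 0)
  have hA0 : 0 ≤ A := (norm_nonneg _).trans (hA 0 0 (by norm_num))
  have hKc0 : 0 ≤ Kc := (norm_nonneg _).trans (hG.norm_iteratedFDeriv_le 0 0 (by norm_num))
  have hu : 0 < B.umin := B.umin_pos
  have hwp : 0 < w := hG.wmin_pos
  have h0r : |(0 : ℝ)| < r := by rw [abs_zero]; exact hr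
  have hM : 0 ≤ msD A₃ A₄ 1 := (norm_nonneg _).trans (norm_iteratedDeriv_levelPoint_le hA hA20 hd hlo hhi hA₃ hA₄ h0r le_rfl (by norm_num) 0)
  have hC₀0 : 0 ≤ C₀ := by rw [hC₀]; positivity
  have hDpos : 0 < D := hδ₀.trans_le hmin
  have hloI : lo ∈ Icc lo hi := left_mem_Icc.2 hlohi
  have hX00 : 0 ≤ X₀ := (abs_nonneg _).trans (hX0 lo hloI)
  have hW0 : 0 ≤ W := (hw0 lo hloI).trans (hwW lo hloI)
  -- the caustic distance at the fold point and at the angle `y`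
  have hD5a : ‖S - v - (2 : ℝ) • levelPoint μ K 0 (vs + θ)‖ ≤ C₀ * δ₀ := by
    have h := norm_caustic_le_of_foldPoint hA hA20 hd hr hlo hhi hA₃ hA₄ hK₁ hG S m θ hcrit hDist hΔ hΔu hΔr
    rw [← hδ₀def, abs_of_pos hδ₀, ← hv] at h
    rw [hC₀]; exact h
  have hDy : ‖S - v - (2 : ℝ) • levelPoint μ K 0 (y + θ)‖ ≤ C₀ * D + 2 * msD A₃ A₄ 1 * |y - vs| := by
    have h := norm_caustic_sub_two_smul_le hA hA20 hd hlo hhi hA₃ hA₄ S v h0r θ vs y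
    rw [abs_zero, zero_div, zero_add] at h
    have h2 : C₀ * δ₀ ≤ C₀ * D := mul_le_mul_of_nonneg_left hmin hC₀0
    linarith
  -- the two deformation rows
  have hdev : ∀ e ∈ Icc lo hi, |frameLevel μ K (S - levelPoint μ K e (y + θ)) - (D - e)| ≤ e / 2 := fun e he => by
    have he0 : 0 ≤ e := hlo0.le.trans he.1
    have h := abs_partnerBand_sub_antidiagonal_le_half hA hd hlo hhi hK₂ S m (y + θ) he0 (lt_of_le_of_lt he.2 hhir)
      (fun s hs => hratey s ⟨hs.1, hs.2.trans he.2⟩)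
    rw [← hDdef] at h
    have e1 : frameLevel μ K (S - levelPoint μ K e (y + θ)) - (D - e) = frameLevel μ K (S - levelPoint μ K e (y + θ)) - D + e := by ring
    rw [e1]; exact h
  obtain ⟨c₁, hc₁⟩ : ∃ c₁ : ℝ, c₁ = K₂ / (B.Dtmin - 2 * A) * (C₀ * D + 2 * msD A₃ A₄ 1 * |y - vs|) := ⟨_, rfl⟩
  have hc₁0 : 0 ≤ c₁ := by rw [hc₁]; positivity
  have hKd0 : 0 ≤ 2 * K₂ / (B.Dtmin - 2 * A) ^ 2 := by positivity
  have hdev2 : ∀ e ∈ Icc lo hi, |frameLevel μ K (S - levelPoint μ K e (y + θ)) - (D - e)| ≤ c₁ * e + 2 * K₂ / (B.Dtmin - 2 * A) ^ 2 * e ^ 2 := fun e he => by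
    have he0 : 0 ≤ e := hlo0.le.trans he.1
    have her : e < r := lt_of_le_of_lt he.2 hhir
    have h := abs_partnerBand_sub_antidiagonal_le hA hA20 hd hlo hhi hA₃ hA₄ hK₂ S m (y + θ) he0 le_rfl her
    rw [← hDdef, ← hv] at h
    have e1 : frameLevel μ K (S - levelPoint μ K e (y + θ)) - (D - e) = frameLevel μ K (S - levelPoint μ K e (y + θ)) - D + e := by ring
    rw [e1]
    refine h.trans ?_
    have h1 : K₂ / (B.Dtmin - 2 * A) * (‖S - v - (2 : ℝ) • levelPoint μ K 0 (y + θ)‖ + 2 * e / (B.Dtmin - 2 * A)) * e ≤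
        K₂ / (B.Dtmin - 2 * A) * (C₀ * D + 2 * msD A₃ A₄ 1 * |y - vs| + 2 * e / (B.Dtmin - 2 * A)) * e :=
      mul_le_mul_of_nonneg_right (mul_le_mul_of_nonneg_left (by linarith [hDy]) (by positivity)) he0
    refine h1.trans (le_of_eq ?_)
    rw [hc₁]; field_simp
  -- integrability of the two integrands (continuity)
  have hgc : ContinuousOn (fun e : ℝ => frameLevel μ K (S - levelPoint μ K e (y + θ))) (Icc lo hi) := fun e he =>
    (hasDerivAt_partnerBand_level hA hd hlo hhi S (abs_lt.2 ⟨by linarith [he.1], lt_of_le_of_lt he.2 hhir⟩) (y + θ)).continuousAt.continuousWithinAt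
  have hfi : IntervalIntegrable (fun e => wt e * X e * deriv (Kr e) (frameLevel μ K (S - levelPoint μ K e (y + θ)))) volume lo hi := by
    refine ContinuousOn.intervalIntegrable ?_
    rw [uIcc_of_le hlohi]
    exact (hwc.mul hXc).mul (hKc.comp_continuousOn (continuousOn_id.prodMk hgc))
  have hgi : IntervalIntegrable (fun e => wt e * deriv (Kr e) (D - e)) volume lo hi := by
    refine ContinuousOn.intervalIntegrable ?_
    rw [uIcc_of_le hlohi]
    exact hwc.mul (hKc.comp_continuousOn (continuousOn_id.prodMk (continuousOn_const.sub continuousOn_id)))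
  -- the comparable-levels level line
  have hAt0 : 0 ≤ Afl * (lo / (max D lo) ^ 2) + Bfl := by positivity
  have hmain := abs_intervalIntegral_levelLine_middle_le (eb := fun e => frameLevel μ K (S - levelPoint μ K e (y + θ))) (At := Afl * (lo / (max D lo) ^ 2) + Bfl)
    hlo0 hlohi hDpos hqc hX₁ hc₁0 hKd0 hCt hAt0 hK hK1 hK2 hcomp hKopp hflatB hfi hgi hw0 hwW hX0 hXL hdev hdev2
  refine hmain.trans (le_of_eq ?_)
  -- bookkeeping of the constants
  have hD0 : D ≠ 0 := hDpos.ne'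
  have hd0 : B.Dtmin - 2 * A ≠ 0 := hDt.ne'
  rw [hc₁]
  field_simp
  ring

end Sizes

end Summit.HubbardSuperconductivity.HubbardSuperconductivity.Theorems.C4a

end
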